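import Summits.AtomisticToContinuum.Crystallization.Theorems.FrustratedLawDichotomySignedLedgerRegimes
import Summits.AtomisticToContinuum.Crystallization.Theorems.PalmUnimodularRigidityBenjaminiSchrammLimitEmbedding

/-!
# FrustratedLawDichotomy · crux `AperiodicFrustratedLawGap` (stmt-AtomisticToContinuum-27623) — THE ROOT-FREE HARD-CORE CLASS (regimes that survive re-rooting)
# (decomp-a2c hand-2 g45, STRUCTURAL share #52: DEF-FREE companion of `…SignedLedgerErgodic` §2 / `…SignedLedgerRegimes`)

The residual's ergodicity clause (verbatim in `S_aperiodicErgodicGap`) only speaks about sets of measures `A` that are MEASURABLE and RE-ROOTING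
INVARIANT FOR EVERY MEASURE with an atom `p` (`μ {p} ≠ 0 → (μ ∈ A ↔ θ_p μ ∈ A)`) — not just for rooted hard-core configurations.  The rooted class
`{μ | IsRootedHardCore δ μ}` itself is NOT of this kind (re-rooting an UNROOTED separated counting measure at an atom lands in it), so regimes of
the form «rooted hard-core ∧ …» cannot be fed to the clause.  This file types, with NO new definitions, the ROOT-FREE class that can: the
**ball condition** `∀ n q, q < δ/2 → μ (ball (denseSeq n) q) ∈ {0, 1}` (countably many evaluations; the tree's recognition lemma
`…BenjaminiSchrammLimit.isRootedHardCore_iff_balls` is «root mass one ∧ ball condition»):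

* §1 `measurableSet_setOf_ballCondition` (Giry-measurable), `ballCondition_of_isRootedHardCore`, `ae_ballCondition` (full measure under every law
  a.s. carried by rooted `δ`-hard-core configurations);
* §2 `measure_ball_zero_or_one_of_ballCondition` — the condition at the countably many rational balls gives it at EVERY ball of radius `< δ/2`
  (exhaustion by concentric balls) —, hence ★ `ballCondition_map_sub_iff`: the class is invariant under EVERY translation of EVERY measure, in
  particular re-rooting invariant in the clause's sense (`setOf_ballCondition_rerootInvariant`);
* §3 ★ `exists_eq_count_restrict_of_ballCondition` — a measure with the ball condition IS the counting measure of a `δ`-separated (closed, possibly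
  empty, possibly unrooted) set (the tree's recognition argument without the root), and `isRootedHardCore_map_sub_of_ballCondition` — re-rooting it at
  any atom gives a ROOTED `δ`-hard-core configuration; `ballCondition_iff_exists_count_restrict` packages §3 as an iff.

Use (next file): intersecting a hard-core-level regime with this class instead of the rooted class keeps it admissible for the clause.
Tags: [folklore: point-process measurability].
-/

noncomputable section

namespace Summit.AtomisticToContinuum.Crystallization.Theorems.FrustratedLawDichotomySignedLedgerHardCoreClass

open MeasureTheory Metric Set Filter TopologicalSpace
open scoped ENNReal Topology BigOperators
open Literature.Probability.Process
open Summit.AtomisticToContinuum.Crystallization.Theorems.ChargedEnergyGapNegative (E3)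
open Summit.AtomisticToContinuum.Crystallization.Theorems.BenjaminiSchrammLimit
  (exists_small_ball isRootedHardCore_iff_balls measure_ball_small_of_isRootedHardCore measurableSet_setOf_isRootedHardCore)
open Literature.Probability.Process.LocalConfig (finite_inter_of_separated isClosed_of_separated)

variable {δ : ℝ}

/-! ## §1. The ball condition: measurable, and of full measure under hard-core laws -/

/-- **The ball condition cuts out a Giry-measurable set of measures** (countably many evaluations). [folklore] -/
theorem measurableSet_setOf_ballCondition (δ : ℝ) :
    MeasurableSet {μ : Measure E3 | ∀ n : ℕ, ∀ q : ℚ, (q : ℝ) < δ / 2 →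
      μ (ball (denseSeq E3 n) q) = 0 ∨ μ (ball (denseSeq E3 n) q) = 1} := by
  have hrepr : {μ : Measure E3 | ∀ n : ℕ, ∀ q : ℚ, (q : ℝ) < δ / 2 →
      μ (ball (denseSeq E3 n) q) = 0 ∨ μ (ball (denseSeq E3 n) q) = 1} =
      ⋂ (n : ℕ) (q : ℚ), {μ : Measure E3 | (q : ℝ) < δ / 2 →
        μ (ball (denseSeq E3 n) q) = 0 ∨ μ (ball (denseSeq E3 n) q) = 1} := by
    ext μ
    simp only [mem_setOf_eq, mem_iInter]
  rw [hrepr]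
  refine MeasurableSet.iInter fun n => MeasurableSet.iInter fun q => ?_
  by_cases hq : (q : ℝ) < δ / 2
  · have hm := Measure.measurable_coe (α := E3) (measurableSet_ball (x := denseSeq E3 n) (ε := q))
    have h01 : MeasurableSet ({μ : Measure E3 | μ (ball (denseSeq E3 n) q) = 0} ∪
        {μ : Measure E3 | μ (ball (denseSeq E3 n) q) = 1}) :=
      (hm (measurableSet_singleton 0)).union (hm (measurableSet_singleton 1))
    convert h01 using 1
    ext μ
    simp only [mem_setOf_eq, hq, true_imp_iff, mem_union]
  · convert MeasurableSet.univ (α := Measure E3)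
    ext μ
    simp only [mem_setOf_eq, hq, false_imp_iff, mem_univ]

/-- A rooted `δ`-hard-core configuration satisfies the ball condition. [folklore] -/
theorem ballCondition_of_isRootedHardCore {μ : Measure E3} (h : IsRootedHardCore δ μ) :
    ∀ n : ℕ, ∀ q : ℚ, (q : ℝ) < δ / 2 → μ (ball (denseSeq E3 n) q) = 0 ∨ μ (ball (denseSeq E3 n) q) = 1 :=
  fun n _ hq => measure_ball_small_of_isRootedHardCore h (denseSeq E3 n) hq

/-- Under a law almost surely carried by rooted `δ`-hard-core configurations the ball condition holds almost surely. [folklore] -/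
theorem ae_ballCondition {P : Measure (Measure E3)} (hcore : ∀ᵐ μ ∂P, IsRootedHardCore δ μ) :
    ∀ᵐ μ ∂P, ∀ n : ℕ, ∀ q : ℚ, (q : ℝ) < δ / 2 → μ (ball (denseSeq E3 n) q) = 0 ∨ μ (ball (denseSeq E3 n) q) = 1 := by
  filter_upwards [hcore] with μ hμ using ballCondition_of_isRootedHardCore hμ

/-! ## §2. Every small ball, hence translation invariance -/

/-- **From rational balls to all balls.**  The ball condition at the countably many rational balls gives mass `0` or `1` to EVERY open
ball of radius `< δ/2` (exhaust `ball c r` by the concentric balls `ball c (r − r/(k+1))`, each inside a rational ball inside `ball c r`). [folklore] -/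
theorem measure_ball_zero_or_one_of_ballCondition {μ : Measure E3}
    (hU : ∀ n : ℕ, ∀ q : ℚ, (q : ℝ) < δ / 2 → μ (ball (denseSeq E3 n) q) = 0 ∨ μ (ball (denseSeq E3 n) q) = 1)
    (c : E3) {r : ℝ} (hr : r < δ / 2) : μ (ball c r) = 0 ∨ μ (ball c r) = 1 := by
  rcases le_or_gt r 0 with hr0 | hr0
  · left
    rw [Metric.ball_eq_empty.mpr hr0, measure_empty]
  -- inner rational balls between two concentric balls
  have key : ∀ s : ℝ, s < r → ∃ n : ℕ, ∃ q : ℚ, (q : ℝ) < δ / 2 ∧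
      ball c s ⊆ ball (denseSeq E3 n) q ∧ ball (denseSeq E3 n) q ⊆ ball c r := by
    intro s hs
    obtain ⟨q, hq1, hq2⟩ := exists_rat_btwn (show s + (r - s) / 3 < s + 2 * ((r - s) / 3) by linarith)
    obtain ⟨n, hn⟩ := (denseRange_denseSeq E3).exists_dist_lt c (show 0 < (r - s) / 3 by linarith)
    refine ⟨n, q, by linarith, fun x hx => ?_, fun x hx => ?_⟩
    · rw [mem_ball] at hx ⊢
      calc dist x (denseSeq E3 n) ≤ dist x c + dist c (denseSeq E3 n) := dist_triangle _ _ _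
        _ < s + (r - s) / 3 := add_lt_add hx hn
        _ < q := hq1
    · rw [mem_ball] at hx ⊢
      have hn' : dist (denseSeq E3 n) c < (r - s) / 3 := by rwa [dist_comm]
      calc dist x c ≤ dist x (denseSeq E3 n) + dist (denseSeq E3 n) c := dist_triangle _ _ _
        _ < q + (r - s) / 3 := add_lt_add hx hn'
        _ < r := by linarith
  -- exhaustion of `ball c r` by concentric balls
  have hmono : Monotone fun k : ℕ => ball c (r - r / ((k : ℝ) + 1)) := by
    intro a b hab
    apply ball_subset_ball
    have hab' : (a : ℝ) + 1 ≤ (b : ℝ) + 1 := by exact_mod_cast Nat.succ_le_succ hab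
    have : r / ((b : ℝ) + 1) ≤ r / ((a : ℝ) + 1) := div_le_div_of_nonneg_left hr0.le (by positivity) hab'
    linarith
  have hUnion : (⋃ k : ℕ, ball c (r - r / ((k : ℝ) + 1))) = ball c r := by
    apply subset_antisymm
    · refine iUnion_subset fun k => ball_subset_ball ?_
      have : 0 ≤ r / ((k : ℝ) + 1) := by positivity
      linarith
    · intro x hx
      rw [mem_ball] at hx
      have hpos : 0 < r - dist x c := by linarith
      obtain ⟨k, hk⟩ := exists_nat_gt (r / (r - dist x c))
      refine mem_iUnion.mpr ⟨k, mem_ball.mpr ?_⟩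
      have h1 : r < (k : ℝ) * (r - dist x c) := (div_lt_iff₀ hpos).mp hk
      have h2 : r < (r - dist x c) * ((k : ℝ) + 1) := by nlinarith
      have h3 : r / ((k : ℝ) + 1) < r - dist x c := (div_lt_iff₀ (by positivity)).mpr h2
      linarith
  have hsup : μ (ball c r) = ⨆ k : ℕ, μ (ball c (r - r / ((k : ℝ) + 1))) := by
    rw [← hUnion]
    exact hmono.measure_iUnion
  -- each concentric ball has mass ≤ 1, and a non-null one forces mass ≥ 1 on `ball c r`
  have hk : ∀ k : ℕ, μ (ball c (r - r / ((k : ℝ) + 1))) ≤ 1 ∧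
      (μ (ball c (r - r / ((k : ℝ) + 1))) ≠ 0 → 1 ≤ μ (ball c r)) := by
    intro k
    have hs : r - r / ((k : ℝ) + 1) < r := by
      have : 0 < r / ((k : ℝ) + 1) := by positivity
      linarith
    obtain ⟨n, q, hq, h1, h2⟩ := key _ hs
    rcases hU n q hq with h0 | h1'
    · have hz : μ (ball c (r - r / ((k : ℝ) + 1))) = 0 := measure_mono_null h1 h0
      exact ⟨by rw [hz]; exact zero_le, fun h => absurd hz h⟩
    · exact ⟨(measure_mono h1).trans h1'.le, fun _ => h1'.symm.le.trans (measure_mono h2)⟩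
  by_cases hz : ∀ k : ℕ, μ (ball c (r - r / ((k : ℝ) + 1))) = 0
  · left
    rw [hsup]
    exact ENNReal.iSup_eq_zero.mpr hz
  · right
    obtain ⟨k, hk0⟩ := not_forall.mp hz
    apply le_antisymm
    · rw [hsup]
      exact iSup_le fun k => (hk k).1
    · exact (hk k).2 hk0

/-- Translating a measure translates ball masses: `(θ_p μ)(ball c s) = μ (ball (c + p) s)`. [folklore] -/
theorem map_sub_apply_ball (μ : Measure E3) (p c : E3) (s : ℝ) :
    (μ.map fun z : E3 => z - p) (ball c s) = μ (ball (c + p) s) := by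
  rw [Measure.map_apply (measurable_sub_const p) measurableSet_ball]
  congr 1
  ext z
  simp only [mem_preimage, mem_ball, dist_eq_norm, sub_sub, add_comm p c]

/-- **THE BALL CONDITION IS TRANSLATION INVARIANT** (every measure, every translation vector — in particular re-rooting invariant in the sense of
the residual's ergodicity clause). [folklore] -/
theorem ballCondition_map_sub_iff (δ : ℝ) (μ : Measure E3) (p : E3) :
    (∀ n : ℕ, ∀ q : ℚ, (q : ℝ) < δ / 2 → (μ.map fun z : E3 => z - p) (ball (denseSeq E3 n) q) = 0 ∨
        (μ.map fun z : E3 => z - p) (ball (denseSeq E3 n) q) = 1) ↔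
      (∀ n : ℕ, ∀ q : ℚ, (q : ℝ) < δ / 2 → μ (ball (denseSeq E3 n) q) = 0 ∨ μ (ball (denseSeq E3 n) q) = 1) := by
  constructor
  · intro h n q hq
    have h' := measure_ball_zero_or_one_of_ballCondition h (denseSeq E3 n - p) hq
    rwa [map_sub_apply_ball, sub_add_cancel] at h'
  · intro h n q hq
    rw [map_sub_apply_ball]
    exact measure_ball_zero_or_one_of_ballCondition h _ hq

/-- The set-level form: the ball-condition class is re-rooting invariant for the ergodicity clause (the atom hypothesis is not even used). [folklore] -/
theorem setOf_ballCondition_rerootInvariant (δ : ℝ) :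
    ∀ μ : Measure E3, ∀ p : E3, μ {p} ≠ 0 →
      (μ ∈ {μ : Measure E3 | ∀ n : ℕ, ∀ q : ℚ, (q : ℝ) < δ / 2 →
          μ (ball (denseSeq E3 n) q) = 0 ∨ μ (ball (denseSeq E3 n) q) = 1} ↔
        Measure.map (fun z : E3 => z - p) μ ∈ {μ : Measure E3 | ∀ n : ℕ, ∀ q : ℚ, (q : ℝ) < δ / 2 →
          μ (ball (denseSeq E3 n) q) = 0 ∨ μ (ball (denseSeq E3 n) q) = 1}) :=
  fun μ p _ => by rw [mem_setOf_eq, mem_setOf_eq, ballCondition_map_sub_iff δ]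

/-! ## §3. Recognition without the root: ball condition ⟹ counting measure of a separated set -/

/-- **RECOGNITION LEMMA, ROOT-FREE.**  For `δ > 0`, a measure with the ball condition is the counting measure of a `δ`-separated set
(the complement of the union of the null rational balls; the tree's argument for `isRootedHardCore_iff_balls` without the root). [folklore] -/
theorem exists_eq_count_restrict_of_ballCondition (hδ : 0 < δ) {μ : Measure E3}
    (hball : ∀ n : ℕ, ∀ q : ℚ, (q : ℝ) < δ / 2 → μ (ball (denseSeq E3 n) q) = 0 ∨ μ (ball (denseSeq E3 n) q) = 1) :
    ∃ S : Set E3, (∀ x ∈ S, ∀ y ∈ S, x ≠ y → δ ≤ dist x y) ∧ μ = (Measure.count : Measure E3).restrict S := by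
  -- the null open set `U₀` and the closed carrier `S`
  set U₀ : Set E3 := ⋃ (n : ℕ) (q : ℚ) (_ : (q : ℝ) < δ / 2 ∧ μ (ball (denseSeq E3 n) q) = 0),
    ball (denseSeq E3 n) q with hU₀
  have hU₀null : μ U₀ = 0 := by
    rw [hU₀]
    refine measure_iUnion_null fun n => measure_iUnion_null fun q => ?_
    exact measure_iUnion_null fun hq => hq.2
  set S : Set E3 := U₀ᶜ with hS
  -- basis balls about a point of `S` have mass one
  have hone : ∀ p ∈ S, ∀ n : ℕ, ∀ q : ℚ, (q : ℝ) < δ / 2 → p ∈ ball (denseSeq E3 n) q →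
      μ (ball (denseSeq E3 n) q) = 1 := by
    intro p hp n q hq hpB
    rcases hball n q hq with h | h
    · exact absurd (mem_iUnion₂.2 ⟨n, q, mem_iUnion.2 ⟨⟨hq, h⟩, hpB⟩⟩) hp
    · exact h
  -- `S` is `δ`-separated
  have hsep : ∀ x ∈ S, ∀ y ∈ S, x ≠ y → δ ≤ dist x y := by
    intro x hx y hy hxy
    by_contra hlt
    rw [not_le] at hlt
    have hxy0 : 0 < dist x y := dist_pos.2 hxy
    set m : E3 := midpoint ℝ x y with hm
    have hmx : dist x m = dist x y / 2 := by
      rw [hm, dist_left_midpoint, Real.norm_ofNat]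
      ring
    have hmy : dist y m = dist x y / 2 := by
      rw [hm, dist_right_midpoint, Real.norm_ofNat]
      ring
    obtain ⟨ρ, hρ1, hρ2⟩ := exists_rat_btwn (show dist x y / 2 < δ / 2 by linarith)
    obtain ⟨n, hn⟩ := (denseRange_denseSeq E3).exists_dist_lt m (show 0 < (ρ : ℝ) - dist x y / 2 by linarith)
    have hxB : x ∈ ball (denseSeq E3 n) ρ := by
      rw [mem_ball]
      calc dist x (denseSeq E3 n) ≤ dist x m + dist m (denseSeq E3 n) := dist_triangle _ _ _
        _ < dist x y / 2 + (ρ - dist x y / 2) := add_lt_add_of_le_of_lt hmx.le hn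
        _ = ρ := by ring
    have hyB : y ∈ ball (denseSeq E3 n) ρ := by
      rw [mem_ball]
      calc dist y (denseSeq E3 n) ≤ dist y m + dist m (denseSeq E3 n) := dist_triangle _ _ _
        _ < dist x y / 2 + (ρ - dist x y / 2) := add_lt_add_of_le_of_lt hmy.le hn
        _ = ρ := by ring
    have hB1 : μ (ball (denseSeq E3 n) ρ) = 1 := hone x hx n ρ hρ2 hxB
    obtain ⟨rx, hrx, hrxB⟩ := Metric.isOpen_iff.1 isOpen_ball x hxB
    obtain ⟨ry, hry, hryB⟩ := Metric.isOpen_iff.1 isOpen_ball y hyB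
    obtain ⟨nx, qx, -, hqx, hxBx, hBx⟩ := exists_small_ball hδ x (lt_min hrx (half_pos hxy0))
    obtain ⟨ny, qy, -, hqy, hyBy, hBy⟩ := exists_small_ball hδ y (lt_min hry (half_pos hxy0))
    have hBx1 : μ (ball (denseSeq E3 nx) qx) = 1 := hone x hx nx qx hqx hxBx
    have hBy1 : μ (ball (denseSeq E3 ny) qy) = 1 := hone y hy ny qy hqy hyBy
    have hdisj : Disjoint (ball (denseSeq E3 nx) qx) (ball (denseSeq E3 ny) qy) := by
      rw [Set.disjoint_left]
      intro z hzx hzy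
      have h1 : dist z x < dist x y / 2 := (mem_ball.1 (hBx hzx)).trans_le (min_le_right _ _)
      have h2 : dist z y < dist x y / 2 := (mem_ball.1 (hBy hzy)).trans_le (min_le_right _ _)
      have := dist_triangle_left x y z
      linarith
    have hsub : ball (denseSeq E3 nx) qx ∪ ball (denseSeq E3 ny) qy ⊆ ball (denseSeq E3 n) ρ :=
      union_subset (hBx.trans ((ball_subset_ball (min_le_left _ _)).trans hrxB))
        (hBy.trans ((ball_subset_ball (min_le_left _ _)).trans hryB))
    have h2 : (2 : ℝ≥0∞) ≤ 1 :=
      calc (2 : ℝ≥0∞) = μ (ball (denseSeq E3 nx) qx) + μ (ball (denseSeq E3 ny) qy) := by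
            rw [hBx1, hBy1]; norm_num
        _ = μ (ball (denseSeq E3 nx) qx ∪ ball (denseSeq E3 ny) qy) := (measure_union hdisj measurableSet_ball).symm
        _ ≤ μ (ball (denseSeq E3 n) ρ) := measure_mono hsub
        _ = 1 := hB1
    exact absurd h2 (by norm_num)
  -- points of `S` carry mass one
  have hpt : ∀ p ∈ S, μ {p} = 1 := by
    intro p hp
    obtain ⟨n, q, -, hq, hpB, hB⟩ := exists_small_ball hδ p (half_pos hδ)
    have hB1 : μ (ball (denseSeq E3 n) q) = 1 := hone p hp n q hq hpB
    refine le_antisymm ?_ ?_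
    · calc μ {p} ≤ μ (ball (denseSeq E3 n) q) := measure_mono (singleton_subset_iff.2 hpB)
        _ = 1 := hB1
    · have hrest : μ (ball (denseSeq E3 n) q \ {p}) = 0 := by
        refine measure_mono_null (fun z hz => ?_) hU₀null
        by_contra hzU
        have hzS : z ∈ S := hzU
        have hzp : z ≠ p := hz.2
        have h1 := hsep z hzS p hp hzp
        have h2 : dist z p < δ / 2 := mem_ball.1 (hB hz.1)
        linarith
      calc (1 : ℝ≥0∞) = μ (ball (denseSeq E3 n) q) := hB1.symm
        _ ≤ μ ({p} ∪ (ball (denseSeq E3 n) q \ {p})) := by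
            refine measure_mono ?_
            rw [union_sdiff_self]
            exact subset_union_right
        _ ≤ μ {p} + μ (ball (denseSeq E3 n) q \ {p}) := measure_union_le _ _
        _ = μ {p} := by rw [hrest, add_zero]
  -- `S` is countable
  have hScount : S.Countable := by
    have : S = ⋃ n : ℕ, closedBall (0 : E3) n ∩ S := by
      ext x
      simp only [mem_iUnion, mem_inter_iff]
      exact ⟨fun hx => ⟨⌈‖x‖⌉₊, mem_closedBall_zero_iff.2 (Nat.le_ceil _), hx⟩, fun ⟨_, _, hx⟩ => hx⟩
    rw [this]
    exact countable_iUnion fun n => (finite_inter_of_separated hδ hsep (isCompact_closedBall _ _)).countable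
  -- `μ = count|S`
  refine ⟨S, hsep, Measure.ext fun A hA => ?_⟩
  have key : ∀ ν : Measure E3, (∀ p ∈ S, ν {p} = 1) → ν (A ∩ S) = ∑' _ : ↥(A ∩ S), (1 : ℝ≥0∞) := by
    intro ν hν
    have h := measure_biUnion (μ := ν) (f := fun p : E3 => ({p} : Set E3))
      (hScount.mono (inter_subset_right (s := A)))
      (fun p _ q _ hpq => disjoint_singleton.2 hpq) fun p _ => measurableSet_singleton p
    rw [biUnion_of_singleton] at h
    rw [h]
    exact tsum_congr fun p => hν p p.2.2
  have hAS : μ (A ∩ S) = ∑' _ : ↥(A ∩ S), (1 : ℝ≥0∞) := key μ hpt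
  have hcount : (Measure.count : Measure E3).restrict S A = ∑' _ : ↥(A ∩ S), (1 : ℝ≥0∞) := by
    rw [Measure.restrict_apply hA]
    exact key _ fun p _ => Measure.count_singleton p
  have hAc : μ (A \ S) = 0 := measure_mono_null (fun z hz => not_notMem.1 hz.2) hU₀null
  have hSm : MeasurableSet S := (isClosed_of_separated hδ hsep).measurableSet
  rw [hcount, ← hAS, ← measure_inter_add_sdiff A hSm, hAc, add_zero]

/-- **The root-free recognition as an iff.** [folklore] -/
theorem ballCondition_iff_exists_count_restrict (hδ : 0 < δ) (μ : Measure E3) :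
    (∀ n : ℕ, ∀ q : ℚ, (q : ℝ) < δ / 2 → μ (ball (denseSeq E3 n) q) = 0 ∨ μ (ball (denseSeq E3 n) q) = 1) ↔
      ∃ S : Set E3, (∀ x ∈ S, ∀ y ∈ S, x ≠ y → δ ≤ dist x y) ∧ μ = (Measure.count : Measure E3).restrict S := by
  refine ⟨exists_eq_count_restrict_of_ballCondition hδ, ?_⟩
  rintro ⟨S, hsep, rfl⟩ n q hq
  rw [Measure.restrict_apply measurableSet_ball]
  have hsub : (ball (denseSeq E3 n) (q : ℝ) ∩ S).Subsingleton := by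
    intro x hx y hy
    by_contra hxy
    have h1 := hsep x hx.2 y hy.2 hxy
    have h2 : dist x y < δ :=
      calc dist x y ≤ dist x (denseSeq E3 n) + dist y (denseSeq E3 n) := dist_triangle_right _ _ _
        _ < q + q := add_lt_add (mem_ball.1 hx.1) (mem_ball.1 hy.1)
        _ < δ := by linarith
    linarith
  rcases hsub.eq_empty_or_singleton with h | ⟨x, hx⟩
  · left
    rw [h, measure_empty]
  · right
    rw [hx, Measure.count_singleton]

/-- **Re-rooting a ball-condition measure at an atom gives a ROOTED `δ`-hard-core configuration.** [folklore] -/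
theorem isRootedHardCore_map_sub_of_ballCondition (hδ : 0 < δ) {μ : Measure E3}
    (hball : ∀ n : ℕ, ∀ q : ℚ, (q : ℝ) < δ / 2 → μ (ball (denseSeq E3 n) q) = 0 ∨ μ (ball (denseSeq E3 n) q) = 1)
    {p : E3} (hp : μ {p} ≠ 0) : IsRootedHardCore δ (μ.map fun z : E3 => z - p) := by
  obtain ⟨S, hsep, rfl⟩ := exists_eq_count_restrict_of_ballCondition hδ hball
  have hpS : p ∈ S := (count_restrict_singleton_ne_zero_iff S p).mp hp
  refine ⟨(fun z : E3 => z - p) '' S, ⟨p, hpS, sub_self p⟩, ?_, map_sub_count_restrict S p⟩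
  rintro _ ⟨x, hx, rfl⟩ _ ⟨x', hx', rfl⟩ hne
  rw [dist_sub_right]
  exact hsep x hx x' hx' fun h => hne (by rw [h])

/-- A ball-condition measure with root mass one is a rooted `δ`-hard-core configuration (the tree's recognition lemma, restated). [folklore] -/
theorem isRootedHardCore_of_ballCondition (hδ : 0 < δ) {μ : Measure E3}
    (hball : ∀ n : ℕ, ∀ q : ℚ, (q : ℝ) < δ / 2 → μ (ball (denseSeq E3 n) q) = 0 ∨ μ (ball (denseSeq E3 n) q) = 1)
    (h0 : μ {0} = 1) : IsRootedHardCore δ μ :=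
  (isRootedHardCore_iff_balls hδ μ).mpr ⟨h0, hball⟩

end Summit.AtomisticToContinuum.Crystallization.Theorems.FrustratedLawDichotomySignedLedgerHardCoreClass

end
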